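import Literature.NumberTheory.LFunctions.AutomaticSequencePowTransducer2
import HarnessLib

/-!
# The transducer of the power automaton, III: `d = 1` for the `p`-th power when `d(A) ∣ p` (Müllner 2017, Prop. 2.25; proved)

Everything in this file is PROVED. Continuing `AutomaticSequencePowTransducer2.lean`: identity
loops of the power transducer `digitRestrict (k^p) (powδ k p δ)` correspond to identity loops of
`δ` of `p` times the length (`isIdLoop_powK_iff`, `mem_loopLengths_powK_iff`); hence if
`d(A) ∣ p` then ALL large lengths are identity-loop lengths of the power transducer and its period
is `1` (`transducerPeriod_powK_eq_one`) — the "`d(A_i) = 1`" half of the group part of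
Prop. 2.25 (Müllner takes `p = lcm(d(A_i) k₀(A_i))`). The companion statement `k₀ = 1` is not yet
formalised.

## References
* C. Müllner, Duke Math. J. 166 (2017), Prop. 2.25 (proof). [Mullner2017]
-/

noncomputable section

open Finset

namespace Literature.NumberTheory.LFunctions

namespace MinImage

variable {σ : Type*} [Fintype σ] [DecidableEq σ] {k p : ℕ}

/-- **Identity loops correspond.** [cite: Mullner2017, Prop. 2.25 (proof)] -/
theorem isIdLoop_powK_iff (hk : 2 ≤ k) (hp : 0 < p) (δ : σ → ℕ → σ)
    (htriv : ∀ q d, k ≤ d → δ q d = q) (M : MinImage (digitRestrict (k ^ p) (powδ k p δ)))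
    {W : List ℕ} (hW : ∀ D ∈ W, D < k ^ p) :
    M.IsIdLoop W ↔ (minImageEquivPow hk hp δ htriv M).IsIdLoop (W.map (msbBlock k p)).flatten := by
  rw [IsIdLoop, IsIdLoop, ← minImageEquivPow_next hk hp δ htriv M hW,
    (minImageEquivPow hk hp δ htriv).apply_eq_iff_eq, T_powK_eq_one_iff hk hp δ htriv M hW]

/-- **Identity-loop lengths correspond**: `n ∈ M_q` for the power transducer iff `p n ∈ M_q` for `δ`.
[cite: Mullner2017, Prop. 2.25 (proof)] -/
theorem mem_loopLengths_powK_iff (hk : 2 ≤ k) (hp : 0 < p) (δ : σ → ℕ → σ)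
    (htriv : ∀ q d, k ≤ d → δ q d = q) (M : MinImage (digitRestrict (k ^ p) (powδ k p δ))) (n : ℕ) :
    n ∈ M.loopLengths (k ^ p) ↔ p * n ∈ (minImageEquivPow hk hp δ htriv M).loopLengths k := by
  have hk1 : 1 < k := hk
  constructor
  · rintro ⟨W, hWd, hWl, hW⟩
    refine ⟨(W.map (msbBlock k p)).flatten, digits_flatten_map_msbBlock hk1 W,
      by rw [length_flatten_map_msbBlock hk1 hWd, hWl], ?_⟩
    exact (isIdLoop_powK_iff hk hp δ htriv M hWd).1 hW
  · rintro ⟨w, hwd, hwl, hw⟩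
    obtain ⟨W, hWd, rfl⟩ := exists_blocks_of_length_dvd hk1 hp _ w rfl hwd (hwl ▸ dvd_mul_right p n)
    refine ⟨W, hWd, ?_, (isIdLoop_powK_iff hk hp δ htriv M hWd).2 hw⟩
    rw [length_flatten_map_msbBlock hk1 hWd] at hwl
    exact Nat.eq_of_mul_eq_mul_left hp hwl

/-- **Müllner 2017, Prop. 2.25 (`d = 1` for the power automaton)**: if `d(A) ∣ p` (`p ≥ 1`) then
the naturally induced transducer of the `p`-th power automaton (base `k^p`, letters `≥ k^p`
trivial) has period `1`. [cite: Mullner2017, Prop. 2.25] -/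
theorem transducerPeriod_powK_eq_one (hk : 2 ≤ k) (hp : 0 < p) (δ : σ → ℕ → σ)
    (htriv : ∀ q d, k ≤ d → δ q d = q) (hdp : transducerPeriod k δ ∣ p) :
    transducerPeriod (k ^ p) (digitRestrict (k ^ p) (powδ k p δ)) = 1 := by
  have hk0 : 0 < k := by omega
  set M := transducerBase (digitRestrict (k ^ p) (powδ k p δ)) with hM
  set N := minImageEquivPow hk hp δ htriv M with hN
  obtain ⟨n₀, hn₀⟩ := exists_mem_loopLengths_of_ge k N
  have hper : N.period k ∣ p := by rw [N.period_eq_transducerPeriod hk0 htriv]; exact hdp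
  have hmem : ∀ n : ℕ, n₀ ≤ n → n ∈ M.loopLengths (k ^ p) := by
    intro n hn
    rw [mem_loopLengths_powK_iff hk hp δ htriv M n]
    exact hn₀ (p * n) (hn.trans (Nat.le_mul_of_pos_left n hp)) (hper.trans (dvd_mul_right p n))
  have h1 : M.period (k ^ p) ∣ n₀ + 1 := period_dvd_of_mem (hmem _ (Nat.le_succ _))
  have h2 : M.period (k ^ p) ∣ n₀ + 1 + 1 := period_dvd_of_mem (hmem _ (by omega))
  have h3 : M.period (k ^ p) ∣ 1 := by
    have := Nat.dvd_sub h2 h1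
    rwa [Nat.add_sub_cancel_left] at this
  rw [transducerPeriod, ← hM]
  exact Nat.dvd_one.1 h3

end MinImage

end Literature.NumberTheory.LFunctions
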